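import Literature.RepresentationTheory.IsotypicFixedRank          -- ★ `eval_injective` (evaluation at `t₀ ≠ 0` is injective on `Hom_G(τ, π)` for irreducible `τ`)
import Mathlib.RepresentationTheory.Irreducible
import Mathlib.LinearAlgebra.Eigenspace.Triangularizable
import Mathlib.LinearAlgebra.Trace
import Mathlib.LinearAlgebra.FiniteDimensional.Lemmas
import HarnessLib

/-!
# Evaluation at a vector embeds `Hom_G(τ, σ)` for irreducible `τ`; transport of weight data; existence of a highest-weight vector

Topic `RepresentationTheory`; namespace `Literature.RepresentationTheory`; THEOREMS ONLY (no `def`, no named fact, no instance, no notation, no `sorry`);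
Mathlib + ★ `IsotypicFixedRank` (`eval_injective`).  Cell `hodgecm-mathlib`, F0∕P3, T1a arch line: generic piece **G2** of the N3 plan of record (A-p14 (g23) 2026-08-31T18:59:57Z) for the stub
`stub_N3 : LevelBound₂₁` of the V19 pay-down line `Cruxes/H413/Lines/F0_T1a_V19KTypeGrowthPaydown.lean` (ED. 1 cdc6bbdbd5a1).

THE STATEMENTS ([KnappVogan1995, §I.3, §IV.6 (highest weights)]; [Bump1997, Thm. 3.4.1]).  `τ` an IRREDUCIBLE representation of `G` on `W` (Mathlib
`Representation.IsIrreducible`), `σ` any representation on `Q`, `w₀ ∈ W` non-zero.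
* §1 (★ `eval_injective`: `j ↦ j w₀ : Hom_G(τ, σ) → Q` is injective — the kernel of a non-zero `G`-map out of an irreducible is `0`) hence
  `finite_and_finrank_intertwiningMap_le_of_eval_mem`: if every `j w₀` lies in a finite-dimensional subspace `T ≤ Q` then `Hom_G(τ, σ)` is finite-dimensional
  with `dim ≤ dim T`.
* §2 TRANSPORT — operators `X_W`, `X_Q` intertwined by every `G`-map (`j (X_W w) = X_Q (j w)`; e.g. the derived action of `𝔨_ℂ`) carry `X_W w₀ = 0`, resp.
  `X_W w₀ = μ w₀`, to `X_Q (j w₀) = 0`, resp. `X_Q (j w₀) = μ (j w₀)`; so **`finrank_intertwiningMap_le_finrank_weightVectors`**: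
  `dim Hom_G(τ, σ) ≤ dim {q ∈ Q | e_Q q = 0, h_Q q = μ q, z_Q q = ζ q}` once `e_W w₀ = 0`, `h_W w₀ = μ w₀`, `z_W w₀ = ζ w₀`.
* §3 EXISTENCE of such `w₀` on a finite-dimensional `W ≠ 0` over an algebraically closed field of characteristic `0`: for `e h z ∈ End W` with `h e − e h = 2e` and
  `z` commuting with `e`, `h`: `ker e ≠ 0` (trace of `h − e h e⁻¹ = 2`), `ker e` is `h`- and `z`-stable, and commuting operators have a joint eigenvector:
  **`exists_highestWeightVector`**.
HONEST LABEL: closes no registered stub by itself.  HC_CM is proved only modulo the 2 remaining named inputs (hLiu418, h413) until rung 0 closes.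

## References
* A. W. Knapp, D. A. Vogan, *Cohomological Induction and Unitary Representations* (1995), §I.3, §IV.6 [KnappVogan1995].
* D. Bump, *Automorphic Forms and Representations* (1997), Thm. 3.4.1 (Schur) [Bump1997].
-/

set_option autoImplicit false

noncomputable section

namespace Literature.RepresentationTheory

universe u v w w'

variable {k : Type u} [Field k] {G : Type v} [Group G]
  {W : Type w} [AddCommGroup W] [Module k W] {Q : Type w'} [AddCommGroup Q] [Module k Q]

/-! ## §1 Evaluation at a non-zero vector: `dim Hom_G(τ, σ) ≤ dim T` (★ `eval_injective`) -/

section Eval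

variable (τ : Representation k G W) (σ : Representation k G Q)

/-- **`dim Hom_G(τ, σ) ≤ dim T`** whenever all the values `j w₀` (`w₀ ≠ 0`, `τ` irreducible) lie in a finite-dimensional subspace `T ≤ Q`; in particular
`Hom_G(τ, σ)` is finite-dimensional. [cite: KnappVogan1995, §I.3] -/
theorem finite_and_finrank_intertwiningMap_le_of_eval_mem [τ.IsIrreducible] {w₀ : W} (hw₀ : w₀ ≠ 0) (T : Submodule k Q)
    [FiniteDimensional k T] (hT : ∀ j : Representation.IntertwiningMap τ σ, j w₀ ∈ T) :
    Module.Finite k (Representation.IntertwiningMap τ σ) ∧ Module.finrank k (Representation.IntertwiningMap τ σ) ≤ Module.finrank k T := by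
  let ev : Representation.IntertwiningMap τ σ →ₗ[k] T :=
    { toFun := fun j => ⟨j w₀, hT j⟩
      map_add' := fun j j' => rfl
      map_smul' := fun c j => rfl }
  have hev : Function.Injective (T.subtype ∘ₗ ev) :=
    eval_injective τ σ hw₀ (T.subtype ∘ₗ ev) fun j => rfl
  have hinj : Function.Injective ev := fun j j' h => hev (by simp only [LinearMap.coe_comp, Function.comp_apply, h])
  exact ⟨Module.Finite.of_injective ev hinj, LinearMap.finrank_le_finrank_of_injective hinj⟩

end Eval

/-! ## §2 Transport of annihilation ∕ eigenvalue conditions along `G`-maps -/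

section Transport

variable (τ : Representation k G W) (σ : Representation k G Q)

/-- Transport of annihilation: if every `G`-map intertwines `X_W` and `X_Q`, then `X_W w₀ = 0 ⇒ X_Q (j w₀) = 0`. [cite: KnappVogan1995, §IV.6] -/
theorem apply_eval_eq_zero_of_intertwine {X_W : Module.End k W} {X_Q : Module.End k Q}
    (hX : ∀ (j : Representation.IntertwiningMap τ σ) (w : W), j (X_W w) = X_Q (j w)) {w₀ : W} (h0 : X_W w₀ = 0)
    (j : Representation.IntertwiningMap τ σ) : X_Q (j w₀) = 0 := by
  rw [← hX, h0, map_zero]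

/-- Transport of eigenvalues: if every `G`-map intertwines `X_W` and `X_Q`, then `X_W w₀ = μ w₀ ⇒ X_Q (j w₀) = μ (j w₀)`. [cite: KnappVogan1995, §IV.6] -/
theorem apply_eval_eq_smul_of_intertwine {X_W : Module.End k W} {X_Q : Module.End k Q}
    (hX : ∀ (j : Representation.IntertwiningMap τ σ) (w : W), j (X_W w) = X_Q (j w)) {w₀ : W} {μ : k} (hμ : X_W w₀ = μ • w₀)
    (j : Representation.IntertwiningMap τ σ) : X_Q (j w₀) = μ • j w₀ := by
  rw [← hX, hμ, map_smul]

/-- **G2: `dim Hom_G(τ, σ) ≤ dim {q ∈ Q | e q = 0, h q = μ q, z q = ζ q}`** — for `τ` irreducible with a vector `w₀ ≠ 0` killed by `e_W` of `h_W`-weight `μ`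
and `z_W`-eigenvalue `ζ`, operators intertwined with `e_Q, h_Q, z_Q` by every `G`-map, `Q` finite-dimensional.
[cite: KnappVogan1995, §IV.6] [cite: KnappVogan1995, §I.3] -/
theorem finrank_intertwiningMap_le_finrank_weightVectors [τ.IsIrreducible] [FiniteDimensional k Q]
    {e_W h_W z_W : Module.End k W} {e_Q h_Q z_Q : Module.End k Q}
    (he : ∀ (j : Representation.IntertwiningMap τ σ) (w : W), j (e_W w) = e_Q (j w))
    (hh : ∀ (j : Representation.IntertwiningMap τ σ) (w : W), j (h_W w) = h_Q (j w))
    (hz : ∀ (j : Representation.IntertwiningMap τ σ) (w : W), j (z_W w) = z_Q (j w))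
    {w₀ : W} (hw₀ : w₀ ≠ 0) {μ ζ : k} (he0 : e_W w₀ = 0) (hμ : h_W w₀ = μ • w₀) (hζ : z_W w₀ = ζ • w₀) :
    Module.Finite k (Representation.IntertwiningMap τ σ) ∧
      Module.finrank k (Representation.IntertwiningMap τ σ) ≤
        Module.finrank k ↥(LinearMap.ker e_Q ⊓ Module.End.eigenspace h_Q μ ⊓ Module.End.eigenspace z_Q ζ) := by
  refine finite_and_finrank_intertwiningMap_le_of_eval_mem τ σ hw₀ _ fun j => ⟨⟨?_, ?_⟩, ?_⟩
  · exact apply_eval_eq_zero_of_intertwine τ σ he he0 j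
  · exact Module.End.mem_eigenspace_iff.mpr (apply_eval_eq_smul_of_intertwine τ σ hh hμ j)
  · exact Module.End.mem_eigenspace_iff.mpr (apply_eval_eq_smul_of_intertwine τ σ hz hζ j)

end Transport

/-! ## §3 Existence of a highest-weight vector -/

section HighestWeight

variable [IsAlgClosed k] [CharZero k] [FiniteDimensional k W]

omit [IsAlgClosed k] in
/-- **`e` is not injective** on a finite-dimensional `W ≠ 0` in characteristic `0` if `h e − e h = 2 e` for some `h`: otherwise `e` is invertible and
`h − e h e⁻¹ = 2`, whose trace reads `0 = 2 dim W`. [cite: KnappVogan1995, §IV.6] -/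
theorem ker_ne_bot_of_bracket_eq_two_smul [Nontrivial W] (e h : Module.End k W) (heh : h * e - e * h = (2 : k) • e) :
    LinearMap.ker e ≠ ⊥ := by
  intro hker
  have hinj : Function.Injective e := LinearMap.ker_eq_bot.mp hker
  have hbij : Function.Bijective e := ⟨hinj, LinearMap.surjective_of_injective hinj⟩
  obtain ⟨u, hu⟩ : IsUnit e := (Module.End.isUnit_iff e).mpr hbij
  subst hu
  -- `h - u h u⁻¹ = 2 • 1`
  have h1 : h - (↑u * h) * ↑u⁻¹ = (2 : k) • (1 : Module.End k W) := by
    calc h - (↑u * h) * ↑u⁻¹ = (h * ↑u - ↑u * h) * ↑u⁻¹ := by rw [sub_mul, mul_assoc h, Units.mul_inv, mul_one]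
      _ = ((2 : k) • (↑u : Module.End k W)) * ↑u⁻¹ := by rw [heh]
      _ = (2 : k) • (1 : Module.End k W) := by rw [smul_mul_assoc, Units.mul_inv]
  have htr2 : LinearMap.trace k W ((↑u * h) * ↑u⁻¹) = LinearMap.trace k W h := by
    rw [LinearMap.trace_mul_comm, ← mul_assoc, Units.inv_mul, one_mul]
  have htr := congrArg (LinearMap.trace k W) h1
  rw [map_sub, htr2, sub_self, map_smul, LinearMap.trace_one, smul_eq_mul] at htr
  have hfin : (Module.finrank k W : k) = 0 := (mul_eq_zero.mp htr.symm).resolve_left two_ne_zero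
  exact (Module.finrank_pos (R := k) (M := W)).ne' (by exact_mod_cast hfin)

omit [CharZero k] [FiniteDimensional k W] in
/-- Commuting operators on a finite-dimensional `U ≠ 0` over an algebraically closed field have a joint eigenvector. [cite: KnappVogan1995, §IV.6] -/
theorem exists_joint_eigenvector {U : Type*} [AddCommGroup U] [Module k U] [FiniteDimensional k U] [Nontrivial U] (a b : Module.End k U)
    (hab : Commute a b) : ∃ u : U, u ≠ 0 ∧ ∃ μ ζ : k, a u = μ • u ∧ b u = ζ • u := by
  obtain ⟨μ, hμ⟩ := Module.End.exists_eigenvalue a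
  -- `b` preserves the eigenspace `E := eigenspace a μ ≠ 0`
  have hmaps : ∀ x ∈ Module.End.eigenspace a μ, b x ∈ Module.End.eigenspace a μ := fun x hx =>
    Module.End.mapsTo_genEigenspace_of_comm hab μ 1 hx
  haveI : Nontrivial (Module.End.eigenspace a μ) := Submodule.nontrivial_iff_ne_bot.mpr hμ
  obtain ⟨ζ, hζ⟩ := Module.End.exists_eigenvalue (b.restrict hmaps)
  obtain ⟨v, hv, hv0⟩ := hζ.exists_hasEigenvector
  refine ⟨(v : U), fun h => hv0 (Subtype.ext h), μ, ζ, Module.End.mem_eigenspace_iff.mp v.2, ?_⟩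
  have h1 := Module.End.mem_eigenspace_iff.mp hv
  have h2 := congrArg (fun x : Module.End.eigenspace a μ => (x : U)) h1
  simpa [LinearMap.restrict_apply] using h2

/-- **EXISTENCE OF A HIGHEST-WEIGHT VECTOR.**  On a finite-dimensional `W ≠ 0` over an algebraically closed field of characteristic `0`, operators `e h z` with
`h e − e h = 2 e` and `z` commuting with `e` and `h` admit `w₀ ≠ 0` with `e w₀ = 0`, `h w₀ = μ w₀`, `z w₀ = ζ w₀`. [cite: KnappVogan1995, §IV.6] -/
theorem exists_highestWeightVector [Nontrivial W] (e h z : Module.End k W) (heh : h * e - e * h = (2 : k) • e) (hze : Commute z e)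
    (hzh : Commute z h) : ∃ w₀ : W, w₀ ≠ 0 ∧ ∃ μ ζ : k, e w₀ = 0 ∧ h w₀ = μ • w₀ ∧ z w₀ = ζ • w₀ := by
  -- `K := ker e ≠ 0` is `h`- and `z`-stable
  have hK : LinearMap.ker e ≠ ⊥ := ker_ne_bot_of_bracket_eq_two_smul e h heh
  have hhK : ∀ x ∈ LinearMap.ker e, h x ∈ LinearMap.ker e := by
    intro x hx
    rw [LinearMap.mem_ker] at hx ⊢
    -- `e (h x) = h (e x) - 2 e x = 0`
    have h1 := LinearMap.congr_fun heh x
    simp only [LinearMap.sub_apply, Module.End.mul_apply, LinearMap.smul_apply, hx, map_zero, smul_zero] at h1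
    -- h1 : 0 - e (h x) = 0
    simpa using h1
  have hzK : ∀ x ∈ LinearMap.ker e, z x ∈ LinearMap.ker e := by
    intro x hx
    rw [LinearMap.mem_ker] at hx ⊢
    have h1 : e (z x) = z (e x) := by
      change (e * z) x = (z * e) x
      rw [hze.eq]
    rw [h1, hx, map_zero]
  haveI : Nontrivial (LinearMap.ker e) := Submodule.nontrivial_iff_ne_bot.mpr hK
  have hcomm : Commute (h.restrict hhK) (z.restrict hzK) := by
    apply LinearMap.ext
    intro x
    apply Subtype.ext
    simp only [Module.End.mul_apply, LinearMap.restrict_apply]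
    exact (LinearMap.congr_fun hzh.eq (x : W)).symm
  obtain ⟨u, hu0, μ, ζ, hμ, hζ⟩ := exists_joint_eigenvector (h.restrict hhK) (z.restrict hzK) hcomm
  refine ⟨(u : W), fun h0 => hu0 (Subtype.ext h0), μ, ζ, u.2, ?_, ?_⟩
  · have h1 := congrArg (fun x : LinearMap.ker e => (x : W)) hμ
    simpa [LinearMap.restrict_apply] using h1
  · have h1 := congrArg (fun x : LinearMap.ker e => (x : W)) hζ
    simpa [LinearMap.restrict_apply] using h1

end HighestWeight

end Literature.RepresentationTheory

end
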